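import Literature.Probability.Percolation.ArmSeparationMove
import HarnessLib

/-!
# The white move: landing the closed arm through `negFlip`

Topic: Probability / Percolation; family `crit-perc`. A brick of the discharge of
`Literature.Probability.Percolation.Nolin2008_twoArm_separation` (Nolin 2008, Thm. 11
[arXiv 0711.4948: Thm. 10], `j = 2`, `σ = BW`; `ArmSeparation.lean`), landing step of the internal
extremities (Nolin 2008, Prop. 12 [arXiv Prop. 11]). The closed (white) arm of `ω` with its
fenced inner tip in the frame `ic` is an open arm of `negFlip ω = {v | -v ∉ ω}` with its tip in
the frame `(ic + 3) mod 6`: the family of frames is closed under the central symmetry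
(`frameIso_add_three`: `frameIso (i+3) = -frameIso i`), so `(frameConfig i ω)ᶜ = frameConfig (i+3 mod 6) (negFlip ω)`
(`compl_frameConfig_eq`). Hence the landing move (`landing_move`, `ArmSeparationMove.lean`)
applied to `negFlip ω` lands the white arm on the left side of `∂Λ_n`, i.e. gives
`negFlip ω ∈ sepOpenArm n N`, the second half of `sepTwoArm n N`.

* `frameIso_add_three`, `compl_frameConfig_eq`, `image_symm_neg_preimage_eq`;
* `IntFencedArm.transport` — moving a fenced arm along equalities of its region and configuration;
* `white_landing_move`.

## References

* P. Nolin, *Near-critical percolation in two dimensions*, Electron. J. Probab. 13 (2008), §4.2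
  Def. 6–8, §4.3 Prop. 12, §4.4 [arXiv 0711.4948: Def. 6–8, Prop. 11, Thm. 10]. [Nolin2008]
* S. Smirnov, W. Werner, *Critical exponents for two-dimensional percolation*, Math. Res. Lett. 8
  (2001), Rem. 2 (colour exchange). [SmirnovWernerMRL2001]
-/

noncomputable section

open Set

namespace Literature.Probability.Percolation

open LatticeModels HalfAnnulus Tube

/-- **The frames are closed under the central symmetry**: `frameIso ((i + 3) % 6) v = -frameIso i v` (`i < 6`). [folklore] -/
theorem frameIso_add_three {i : ℕ} (hi : i < 6) (v : Site 2) : frameIso ((i + 3) % 6) v = -frameIso i v := by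
  obtain ⟨a0, a1, b0, b1, c0, c1, d0, d1, e0, e1, f0, f1⟩ := frameIso_apply_formula v
  interval_cases i
  · show frameIso 3 v = -frameIso 0 v
    exact Site.eq_iff_two.2 ⟨by rw [Pi.neg_apply]; omega, by rw [Pi.neg_apply]; omega⟩
  · show frameIso 4 v = -frameIso 1 v
    exact Site.eq_iff_two.2 ⟨by rw [Pi.neg_apply]; omega, by rw [Pi.neg_apply]; omega⟩
  · show frameIso 5 v = -frameIso 2 v
    exact Site.eq_iff_two.2 ⟨by rw [Pi.neg_apply]; omega, by rw [Pi.neg_apply]; omega⟩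
  · show frameIso 0 v = -frameIso 3 v
    exact Site.eq_iff_two.2 ⟨by rw [Pi.neg_apply]; omega, by rw [Pi.neg_apply]; omega⟩
  · show frameIso 1 v = -frameIso 4 v
    exact Site.eq_iff_two.2 ⟨by rw [Pi.neg_apply]; omega, by rw [Pi.neg_apply]; omega⟩
  · show frameIso 2 v = -frameIso 5 v
    exact Site.eq_iff_two.2 ⟨by rw [Pi.neg_apply]; omega, by rw [Pi.neg_apply]; omega⟩

/-- **Colour exchange moves the frame by three**: `(frameConfig i ω)ᶜ = frameConfig ((i + 3) % 6) (negFlip ω)` (`i < 6`). [folklore] -/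
theorem compl_frameConfig_eq {i : ℕ} (hi : i < 6) (ω : SiteConfig (Site 2)) :
    (frameConfig i ω)ᶜ = frameConfig ((i + 3) % 6) (negFlip ω) := by
  ext v
  rw [Set.mem_compl_iff, mem_frameConfig, mem_frameConfig, mem_negFlip, frameIso_add_three hi, neg_neg]

/-- The inverse frame of the reflected region is the inverse shifted frame of the region (`i < 6`). [folklore] -/
theorem image_symm_neg_preimage_eq {i : ℕ} (hi : i < 6) (R : Set (Site 2)) :
    (frameIso i).symm '' (Neg.neg ⁻¹' R) = (frameIso ((i + 3) % 6)).symm '' R := by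
  ext u
  constructor
  · rintro ⟨x, hx, rfl⟩
    refine ⟨frameIso ((i + 3) % 6) ((frameIso i).symm x), ?_, RelIso.symm_apply_apply _ _⟩
    rw [frameIso_add_three hi, RelIso.apply_symm_apply]; exact hx
  · rintro ⟨x, hx, rfl⟩
    refine ⟨frameIso i ((frameIso ((i + 3) % 6)).symm x), ?_, RelIso.symm_apply_apply _ _⟩
    rw [Set.mem_preimage, ← frameIso_add_three hi, RelIso.apply_symm_apply]; exact hx

/-- The far end, reflected and reframed: `(frameIso i)⁻¹ (-u) = (frameIso ((i+3) % 6))⁻¹ u` (`i < 6`). [folklore] -/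
theorem frameIso_symm_neg {i : ℕ} (hi : i < 6) (u : Site 2) : (frameIso i).symm (-u) = (frameIso ((i + 3) % 6)).symm u := by
  apply (frameIso ((i + 3) % 6)).injective
  rw [RelIso.apply_symm_apply, frameIso_add_three hi, RelIso.apply_symm_apply, neg_neg]

namespace IntFencedArm

/-- **Transport of a fenced arm** along equalities of its region and of its configuration. [folklore] -/
def transport {m k₀ K R₀ : ℕ} {A A' : Set (Site 2)} {χ χ' : SiteConfig (Site 2)} (hA : A = A') (hχ : χ = χ')
    (F : IntFencedArm m A k₀ K R₀ χ) : IntFencedArm m A' k₀ K R₀ χ' := hA ▸ hχ ▸ F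

/-- Transport keeps the far end. [folklore] -/
@[simp] theorem transport_b {m k₀ K R₀ : ℕ} {A A' : Set (Site 2)} {χ χ' : SiteConfig (Site 2)} (hA : A = A') (hχ : χ = χ')
    (F : IntFencedArm m A k₀ K R₀ χ) : (F.transport hA hχ).b = F.b := by
  subst hA hχ; rfl

/-- Transport keeps the tip. [folklore] -/
@[simp] theorem transport_z {m k₀ K R₀ : ℕ} {A A' : Set (Site 2)} {χ χ' : SiteConfig (Site 2)} (hA : A = A') (hχ : χ = χ')
    (F : IntFencedArm m A k₀ K R₀ χ) : (F.transport hA hχ).z = F.z := by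
  subst hA hχ; rfl

/-- Transport keeps the scale index. [folklore] -/
@[simp] theorem transport_j {m k₀ K R₀ : ℕ} {A A' : Set (Site 2)} {χ χ' : SiteConfig (Site 2)} (hA : A = A') (hχ : χ = χ')
    (F : IntFencedArm m A k₀ K R₀ χ) : (F.transport hA hχ).j = F.j := by
  subst hA hχ; rfl

/-- Transport keeps the scale. [folklore] -/
@[simp] theorem transport_k {m k₀ K R₀ : ℕ} {A A' : Set (Site 2)} {χ χ' : SiteConfig (Site 2)} (hA : A = A') (hχ : χ = χ')
    (F : IntFencedArm m A k₀ K R₀ χ) : (F.transport hA hχ).k = F.k := by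
  subst hA hχ; rfl

end IntFencedArm

/-- **The white landing move.** The closed arm of `ω` attached (in `negFlip ω`) to the outer free
space at `zc ∈ sepLanding N` through `uc`, whose inner tip is a fenced tip of `(frameConfig ic ω)ᶜ`
in the region `(frameIso ic)⁻¹ (-(annulus ∪ ball))` with far end `(frameIso ic)⁻¹ (-uc)` (as
recorded by `IntTinyExt`), is an open arm of `negFlip ω` with a fenced tip of the frame
`ic' = (ic + 3) mod 6`; if the corridor events of the landing move hold for `negFlip ω` in that
frame, then `negFlip ω ∈ sepOpenArm n N`. [cite: Nolin2008, §4.3 Prop. 12 and §4.4 (arXiv 0711.4948: Prop. 11, Thm. 10)] -/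
theorem white_landing_move {m n N k₀ K R₀ : ℕ} {ic : ℕ} (hic : ic < 6) {ω : SiteConfig (Site 2)} {zc uc : Site 2}
    (hzc : zc ∈ sepLanding N)
    (hOut : OpenVCrossThrough (sepOuterFence N zc) (zc 1 - (N / 64 : ℕ)) (zc 1 + (N / 64 : ℕ)) (negFlip ω) uc)
    (Fc : IntFencedArm m ((frameIso ic).symm '' (Neg.neg ⁻¹' (triAnnulusSet m N ∪ triOpenBall zc (N / 8)))) k₀ K R₀ (frameConfig ic ω)ᶜ)
    (hb : Fc.b = (frameIso ic).symm (-uc))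
    {T₀ : ℤ} {w : ℕ} (hwk : 4 * w ≤ Fc.k) (hk : 4 ≤ Fc.k) (hwin : T₀ ≤ Fc.z 1 ∧ Fc.z 1 < T₀ + w)
    (hB : frameConfig ((ic + 3) % 6) (negFlip ω) ∈ triFrameAt (bcnCentre m Fc.k T₀ w) (Fc.k / 2))
    {L ε : ℕ} (hε : 4 * ε ≤ Fc.k) (hL : 2 * Fc.k ≤ L) (hSp : negFlip ω ∈ spokeEvent ((ic + 3) % 6) m Fc.k T₀ w L ε)
    {r e s a len : ℕ} (hs : 1 ≤ s) (hsr : s ∣ r) (hsr' : s ≤ r) (he : 2 * e ≤ r)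
    (harc : negFlip ω ∈ eventAll (arc (thinRing r e s) a len))
    {Te : Tube} (hTe : Te ∈ arc (thinRing r e s) a len) (hJ : SpokeMeets ((ic + 3) % 6) (spokeTube m Fc.k T₀ w L ε) Te)
    {b : Bool} {j₀ d : ℕ} (hSL : ∀ T ∈ vchunks r (-(r : ℤ)) e s j₀ (d + 1), T ∈ arc (thinRing r e s) a len)
    (hlo : -(r : ℤ) + j₀ * s - e ≤ tgtRow n b) (hhi : tgtRow n b + (n / 64 : ℕ) ≤ -(r : ℤ) + (j₀ + d) * s - e)
    {W : ℕ} (hW : (n : ℤ) - (n / 8 : ℕ) + 1 + W = r + 2 * e) (hH : negFlip ω ∈ tgtH n (tgtRow n b) W)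
    (hV : negFlip ω ∈ tgtV n (tgtRow n b))
    (hn : 64 ≤ n) (hnr : (n : ℤ) + s + 2 * e ≤ r) (hrm : (r : ℤ) + 2 * e ≤ m) (hmN : 2 * m ≤ N)
    (hnL : (n : ℤ) + 2 * Fc.k + L ≤ m + 1) (hn5 : (n : ℤ) + 5 * Fc.k ≤ m) (hR : 4 * Fc.k ≤ R₀) :
    negFlip ω ∈ sepOpenArm n N := by
  set Fc' := Fc.transport (image_symm_neg_preimage_eq hic _) (compl_frameConfig_eq hic ω) with hFc'
  have hk' : Fc'.k = Fc.k := IntFencedArm.transport_k _ _ _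
  have hz' : Fc'.z = Fc.z := IntFencedArm.transport_z _ _ _
  have hb' : Fc'.b = (frameIso ((ic + 3) % 6)).symm uc := by
    rw [hFc', IntFencedArm.transport_b, hb, frameIso_symm_neg hic]
  have hi' : (ic + 3) % 6 < 6 := Nat.mod_lt _ (by norm_num)
  refine landing_move hi' hzc hOut Fc' hb' (T₀ := T₀) (w := w) (by rw [hk']; exact hwk) (by rw [hk']; exact hk)
    (by rw [hz']; exact hwin) (by rw [hk']; exact hB) (L := L) (ε := ε) (by rw [hk']; exact hε) (by rw [hk']; exact hL)
    (by rw [hk']; exact hSp) hs hsr hsr' he harc hTe (by rw [hk']; exact hJ) hSL hlo hhi hW hH hV hn hnr hrm hmN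
    (by rw [hk']; exact hnL) (by rw [hk']; exact hn5) (by rw [hk']; exact hR)

end Literature.Probability.Percolation
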